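import Literature.AlgebraicGeometry.Frobenioids.ModelFrobenioidBaseSectionSkeleton
import Literature.AlgebraicGeometry.Frobenioids.ModelFrobenioidBiratNormalized
import Literature.AlgebraicGeometry.Frobenioids.ModelFrobenioidComparison
import Literature.AlgebraicGeometry.Frobenioids.BiratLocalization
import HarnessLib

/-!
# Frobenioids I, Theorem 5.2 (ii), "of model type" — IN FULL for every model Frobenioid over an
# arbitrary base (pre-model ∧ birationally Frobenius-normalized), proof-only

Mochizuki, *The geometry of Frobenioids I: the general theory*, Kyushu J. Math. **62** (2008)
293–400, §5, Theorem 5.2 (ii), kurims p. 101 [cite: MochizukiFrdI2008, Thm. 5.2 (ii) p.101]: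

> "(ii) … `C` is a Frobenioid of isotropic and model — hence birationally Frobenius-normalized
> [cf. Definition 4.5, (i)] — type."

"of model type" = "of pre-model and birationally Frobenius-normalized type" (Def. 4.5 (i), p. 86) —
the tree's `PreFrobenioid.IsOfModelType F hF hsq := IsOfPreModelType F ∧ ∀ A, IsBiratFrobeniusNormalized F hF hsq A`
(`ModelFrobenioidComparison.lean`, the hypothesis form consumed by Thm. 5.2 (iv)).  Both halves are
in the tree for the model Frobenioid of `(Φ, B, Div_B)`: the pre-model half over an ARBITRARY base
(`ModelFrobenioid.isOfPreModelType_of_isDivisorial`, `ModelFrobenioidBaseSectionSkeleton.lean`: the zero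
section over a skeleton of `D`), and the birational half (seat abc-iut-L1-d10's
`ModelFrobenioid.isOfBiratFrobeniusNormalizedType_of_isDivisorial`, `ModelFrobenioidBiratNormalized.lean`)
— the latter, however, in abc-iut-L1-t3's form `PreFrobenioidData.IsOfBiratFrobeniusNormalizedType
(biratData hF hsq)` (operations `C^birat → F_{0_D}`), not in the form `IsBiratFrobeniusNormalized F hF hsq`
(structure functor `C^birat → F_{Φ^gp}`) that `IsOfModelType` asks for.  THIS FILE (theorems only):

* `PreFrobenioid.isBiratFrobeniusNormalized_iff_biratData` — the two tree forms of [FrdI] Def. 4.5 (i)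
  "`A` is birationally Frobenius-normalized" AGREE for every Frobenioid (same base maps and Frobenius
  degrees; the one-directional conversion is implicit in `UnitTrivialModelType.lean`'s
  `isOfBiratFrobeniusNormalizedType_biratData_of_isOfUnitTrivialType`);
* `ModelFrobenioid.isOfModelType` (and `…_of_hasBiratSquares`) — **[FrdI] Thm. 5.2 (ii) "of model type"
  IN FULL**: given that `C → F_Φ` is a Frobenioid (`hF`; Thm. 5.2 (ii), abc-iut-found
  `ModelFrobenioid.isFrobenioid`), `Φ` divisorial and `B` group-like, the model Frobenioid is of model
  type at THE birationalization (square completion `hasBiratSquares_of_isFrobenioid`, Prop. 1.11 (vii)),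
  over ANY base `D`.

No statement of the paper is strengthened (the paper has no skeletality hypothesis); nothing is
redefined.
-/

noncomputable section

namespace Literature.AlgebraicGeometry.Frobenioids

/-! ### The two tree forms of "birationally Frobenius-normalized" agree -/

namespace PreFrobenioid

open CategoryTheory Opposite

universe w' v' v'' u' u''

variable {D : Type u'} [Category.{v'} D] {Φ : Dᵒᵖ ⥤ CommMonCat.{w'}}
  {C : Type u''} [Category.{v''} C] {F : C ⥤ ElemFrobenioid Φ}
  {hF : IsFrobenioid F} {hsq : HasBiratSquares F}

/-- The two renderings of [FrdI] Def. 4.5 (i) "`A` is birationally Frobenius-normalized" in the tree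
agree: Frobenius-normalization of `A^birat` read for the structure functor `C^birat → F_{Φ^gp}`
(`IsBiratFrobeniusNormalized`) iff read for abc-iut-L1-t3's operations `biratData hF hsq`
(`C^birat → F_{0_D}`; the SAME base maps and Frobenius degrees, and `O^▷`, base-identity are defined
through those). [cite: MochizukiFrdI2008, Def. 4.5(i) p.86] -/
theorem isBiratFrobeniusNormalized_iff_biratData (A : C) :
    IsBiratFrobeniusNormalized F hF hsq A ↔
      PreFrobenioidData.IsBiratFrobeniusNormalizedObj (biratData hF hsq) A := by
  change _ ↔ (biratOps hF hsq).IsFrobeniusNormalized ((toBirat F hF hsq).obj A)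
  have hd : ∀ φ : (toBirat F hF hsq).obj A ⟶ (toBirat F hF hsq).obj A,
      (degFr (Birat.toElemGp hF hsq) φ : ℕ) = ((biratOps hF hsq).degFr φ : ℕ) := fun _ => rfl
  constructor
  · intro h φ hφ α hα
    have hφ' : IsBaseIdentity (Birat.toElemGp hF hsq) φ := hφ
    have hα' : α ∈ endSubmonoid (Birat.toElemGp hF hsq) ((toBirat F hF hsq).obj A) := ⟨hα.1, hα.2⟩
    have key := h φ hφ' α hα'
    rw [End.mul_def, End.mul_def, ← hd]
    exact key
  · intro h φ hφ α hα
    have hφ' : (biratOps hF hsq).IsBaseIdentity φ := hφ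
    have hα' : α ∈ (biratOps hF hsq).endSubmonoid ((toBirat F hF hsq).obj A) := ⟨hα.1, hα.2⟩
    have key := h φ hφ' α hα'
    rw [End.mul_def, End.mul_def, ← hd] at key
    exact key

end PreFrobenioid

namespace ModelFrobenioid

open CategoryTheory Opposite

universe w v u

variable {D : Type u} [Category.{v} D] {Φ B : Dᵒᵖ ⥤ CommMonCat.{w}} {DivB : B ⟶ monoidGp Φ}

/-- **[FrdI] Thm. 5.2 (ii), "`C` is a Frobenioid of … model … type" — IN FULL, over an arbitrary base**
(Def. 4.5 (i): pre-model AND birationally Frobenius-normalized, the tree's `PreFrobenioid.IsOfModelType`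
at THE birationalization with its square completion `hasBiratSquares_of_isFrobenioid`): given that
`C → F_Φ` is a Frobenioid (`hF`), `Φ` divisorial and `B` group-like.  Pre-model half: `isOfPreModelType_of_isDivisorial`
(`ModelFrobenioidBaseSectionSkeleton.lean`, no skeletality); birational half: seat abc-iut-L1-d10's `isOfBiratFrobeniusNormalizedType_of_isDivisorial`
through `isBiratFrobeniusNormalized_iff_biratData`. [cite: MochizukiFrdI2008, Thm. 5.2 (ii) p.101] -/
theorem isOfModelType (hF : PreFrobenioid.IsFrobenioid (toElem Φ B DivB))
    (hΦd : Objectwise (fun M _ => IsDivisorial M) Φ)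
    (hBg : Objectwise (fun M _ => IsGroupLike M) B) :
    PreFrobenioid.IsOfModelType (toElem Φ B DivB) hF (PreFrobenioid.hasBiratSquares_of_isFrobenioid hF) :=
  ⟨isOfPreModelType_of_isDivisorial hΦd hBg, fun A =>
    (PreFrobenioid.isBiratFrobeniusNormalized_iff_biratData A).mpr
      ((isOfBiratFrobeniusNormalizedType_of_isDivisorial hF
        (PreFrobenioid.hasBiratSquares_of_isFrobenioid hF) hΦd hBg).obj A)⟩

/-- The same over a given square-completion witness `hsq` of the birationalization.
[cite: MochizukiFrdI2008, Thm. 5.2 (ii) p.101] -/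
theorem isOfModelType_of_hasBiratSquares (hF : PreFrobenioid.IsFrobenioid (toElem Φ B DivB))
    (hsq : PreFrobenioid.HasBiratSquares (toElem Φ B DivB))
    (hΦd : Objectwise (fun M _ => IsDivisorial M) Φ)
    (hBg : Objectwise (fun M _ => IsGroupLike M) B) :
    PreFrobenioid.IsOfModelType (toElem Φ B DivB) hF hsq :=
  ⟨isOfPreModelType_of_isDivisorial hΦd hBg, fun A =>
    (PreFrobenioid.isBiratFrobeniusNormalized_iff_biratData A).mpr
      ((isOfBiratFrobeniusNormalizedType_of_isDivisorial hF hsq hΦd hBg).obj A)⟩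

end ModelFrobenioid

end Literature.AlgebraicGeometry.Frobenioids
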